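import Mathlib
import HarnessLib

/-!
# S1a — COUNTING IRREDUCIBLE COMPONENTS: removing a proper clopen part lowers the count; homeomorphism invariance

[OURS · L1 W4.5c · lead-1 g9] — NOT statements of the manuscript; counted 0; AI-level work, weaker than expert review. Pure topology, for the
COMPONENT-COUNT component of the termination measure of line `s1a-logminvertex` (crux stmt-ResolutionOfSingularities-17941): the kill-open of a
principal centre meets the bad locus in a CLOPEN subset (`…S1aKillClopen`), so a kill that touches the bad locus removes whole components.

* `nIrrComp X := (irreducibleComponents X).ncard`;
* `nIrrComp_eq_of_homeomorph` — invariance under homeomorphism (Mathlibʼs `irreducibleComponentsEquivOfIsPreirreducibleFiber`);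
* `nIrrComp_range_eq_of_isEmbedding` — `nIrrComp X = nIrrComp (range φ)` for an embedding `φ`;
* ★ `nIrrComp_subtype_lt_of_isClopen` — for a CLOPEN `A ⊆ X` with non-empty complement in a space with finitely many irreducible components,
  `nIrrComp A < nIrrComp X` (every component of `A` is the trace of a component of `X` inside `A`; the component of a point off `A` is missed);
* `nIrrComp_pos_iff` — `0 < nIrrComp X ↔ X` non-empty (finitely many components).
-/

set_option linter.dupNamespace false

noncomputable section

universe u v

open Set Topology TopologicalSpace

namespace Summit.ResolutionOfSingularities.ResolutionOfSingularities.Theorems.WildQuotientResolution.S1.CompCount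

/-- **The number of irreducible components** of a topological space (as a natural number; `0` if there are infinitely many). [OURS · L1 W4.5c] -/
def nIrrComp (X : Type u) [TopologicalSpace X] : ℕ := (irreducibleComponents X).ncard

/-- `nIrrComp` as a `Nat.card`. -/
theorem nIrrComp_eq_natCard (X : Type u) [TopologicalSpace X] : nIrrComp X = Nat.card ↥(irreducibleComponents X) :=
  (Nat.card_coe_set_eq _).symm

/-- **Homeomorphism invariance** of the number of irreducible components. [OURS · L1 W4.5c] -/
theorem nIrrComp_eq_of_homeomorph {X : Type u} {Y : Type v} [TopologicalSpace X] [TopologicalSpace Y] (e : X ≃ₜ Y) :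
    nIrrComp X = nIrrComp Y := by
  rw [nIrrComp_eq_natCard, nIrrComp_eq_natCard]
  have E := irreducibleComponentsEquivOfIsPreirreducibleFiber (f := e) e.continuous e.isOpenMap
    (fun y => (Set.subsingleton_singleton.preimage e.injective).isPreirreducible) e.surjective
  exact (Nat.card_congr E.toEquiv).symm

/-- For an embedding `φ : X → Y`, `X` and `range φ` have the same number of irreducible components. [OURS · L1 W4.5c] -/
theorem nIrrComp_range_eq_of_isEmbedding {X : Type u} {Y : Type v} [TopologicalSpace X] [TopologicalSpace Y] {φ : X → Y}
    (hφ : IsEmbedding φ) : nIrrComp ↥(Set.range φ) = nIrrComp X :=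
  (nIrrComp_eq_of_homeomorph hφ.toHomeomorph).symm

/-- With finitely many irreducible components, `0 < nIrrComp X ↔ X` is non-empty. [OURS · L1 W4.5c] -/
theorem nIrrComp_pos_iff {X : Type u} [TopologicalSpace X] (hfin : (irreducibleComponents X).Finite) :
    0 < nIrrComp X ↔ Nonempty X := by
  rw [nIrrComp, Set.ncard_pos hfin]
  constructor
  · rintro ⟨t, ht⟩
    obtain ⟨x, -⟩ := ht.1.nonempty
    exact ⟨x⟩
  · rintro ⟨x⟩
    exact ⟨irreducibleComponent x, irreducibleComponent_mem_irreducibleComponents x⟩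

/-- Every irreducible component of an OPEN subspace `A ⊆ X` is the preimage of an irreducible component of `X` that meets `A`. -/
theorem exists_eq_preimage_of_mem_irreducibleComponents_subtype {X : Type u} [TopologicalSpace X] {A : Set X} (hA : IsOpen A)
    {t' : Set ↥A} (ht' : t' ∈ irreducibleComponents ↥A) :
    ∃ t ∈ irreducibleComponents X, (t ∩ A).Nonempty ∧ t' = Subtype.val ⁻¹' t := by
  have hval : IsOpenEmbedding (Subtype.val : ↥A → X) := hA.isOpenEmbedding_subtypeVal
  -- the image is irreducible, hence inside a component of `X`
  have himg : IsIrreducible (Subtype.val '' t') := ht'.1.image _ continuous_subtype_val.continuousOn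
  obtain ⟨t, ht, hsub⟩ := exists_mem_irreducibleComponents_subset_of_isIrreducible _ himg
  have hmeet : (t ∩ Set.range (Subtype.val : ↥A → X)).Nonempty := by
    obtain ⟨x, hx⟩ := ht'.1.nonempty
    exact ⟨x.1, hsub ⟨x, hx, rfl⟩, x, rfl⟩
  have hpre : Subtype.val ⁻¹' t ∈ irreducibleComponents ↥A := preimage_mem_irreducibleComponents ht hval hmeet
  refine ⟨t, ht, ?_, ?_⟩
  · obtain ⟨y, hyt, x, rfl⟩ := hmeet
    exact ⟨x.1, hyt, x.2⟩
  · -- `t' ⊆ val ⁻¹ t`, and `t'` is maximal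
    have hle : t' ⊆ Subtype.val ⁻¹' t := fun x hx => hsub ⟨x, hx, rfl⟩
    exact Set.Subset.antisymm hle (ht'.2 hpre.1 hle)

/-- ★ **Removing a proper clopen part lowers the number of irreducible components**: for a clopen `A ⊆ X` with `Aᶜ` non-empty, in a space with
finitely many irreducible components, `nIrrComp A < nIrrComp X`. [OURS · L1 W4.5c] -/
theorem nIrrComp_subtype_lt_of_isClopen {X : Type u} [TopologicalSpace X] {A : Set X} (hA : IsClopen A) (hne : Aᶜ.Nonempty)
    (hfin : (irreducibleComponents X).Finite) : nIrrComp ↥A < nIrrComp X := by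
  obtain ⟨x₀, hx₀⟩ := hne
  -- the component of `x₀` lies off `A`
  let t₀ : Set X := irreducibleComponent x₀
  have ht₀ : t₀ ∈ irreducibleComponents X := irreducibleComponent_mem_irreducibleComponents x₀
  have ht₀A : Disjoint t₀ A := by
    rw [Set.disjoint_iff_inter_eq_empty]
    by_contra h
    have hmeet : (t₀ ∩ A).Nonempty := Set.nonempty_iff_ne_empty.mpr h
    have hsub : t₀ ⊆ A := isIrreducible_irreducibleComponent.isPreirreducible.isPreconnected.subset_isClopen hA hmeet
    exact hx₀ (hsub mem_irreducibleComponent)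
  -- every component of `A` comes from a component of `X` other than `t₀`
  have hsub : irreducibleComponents ↥A ⊆ (fun t : Set X => Subtype.val ⁻¹' t) '' (irreducibleComponents X \ {t₀}) := by
    intro t' ht'
    obtain ⟨t, ht, hmeet, rfl⟩ := exists_eq_preimage_of_mem_irreducibleComponents_subtype hA.2 ht'
    refine ⟨t, ⟨ht, fun h => ?_⟩, rfl⟩
    rw [Set.mem_singleton_iff] at h
    subst h
    exact Set.disjoint_iff_inter_eq_empty.mp ht₀A ▸ hmeet |>.ne_empty rfl
  calc nIrrComp ↥A = (irreducibleComponents ↥A).ncard := rfl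
    _ ≤ ((fun t : Set X => Subtype.val ⁻¹' t) '' (irreducibleComponents X \ {t₀})).ncard :=
        Set.ncard_le_ncard hsub ((hfin.sdiff).image _)
    _ ≤ (irreducibleComponents X \ {t₀}).ncard := Set.ncard_image_le hfin.sdiff
    _ < (irreducibleComponents X).ncard := Set.ncard_sdiff_singleton_lt_of_mem ht₀ hfin
    _ = nIrrComp X := rfl

/-- The same for a subset `Z ⊆ V` and a set `S` whose trace on `Z` is clopen and non-empty: `nIrrComp (Z ∖ S) < nIrrComp Z`. [OURS · L1 W4.5c] -/
theorem nIrrComp_diff_lt {V : Type u} [TopologicalSpace V] {Z S : Set V}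
    (hclopen : IsClopen {z : ↥Z | (z : V) ∈ S}) (hne : (Z ∩ S).Nonempty) (hfin : (irreducibleComponents ↥Z).Finite) :
    nIrrComp ↥(Z \ S) < nIrrComp ↥Z := by
  -- `Z ∖ S` is homeomorphic to the clopen complement `A` of the trace
  let A : Set ↥Z := {z : ↥Z | (z : V) ∈ S}ᶜ
  have hA : IsClopen A := hclopen.compl
  have hAc : Aᶜ.Nonempty := by
    obtain ⟨z, hzZ, hzS⟩ := hne
    exact ⟨⟨z, hzZ⟩, fun h => h hzS⟩
  have e : ↥(Z \ S) ≃ₜ ↥A :=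
    { toFun := fun w => ⟨⟨w.1, w.2.1⟩, w.2.2⟩
      invFun := fun a => ⟨a.1.1, a.1.2, a.2⟩
      left_inv := fun _ => rfl
      right_inv := fun _ => rfl
      continuous_toFun := by fun_prop
      continuous_invFun := by fun_prop }
  rw [nIrrComp_eq_of_homeomorph e]
  exact nIrrComp_subtype_lt_of_isClopen hA hAc hfin

/-- An embedding whose range misses a non-empty clopen trace lowers the number of irreducible components:
if `φ : Y → ↥Z` is an embedding with `range φ ⊆ {z | z ∉ S}`, the trace of `S` clopen and non-empty, then `nIrrComp Y < nIrrComp Z`. [OURS · L1 W4.5c] -/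
theorem nIrrComp_lt_of_isEmbedding {V : Type u} [TopologicalSpace V] {Z S : Set V} {Y : Type v} [TopologicalSpace Y]
    {φ : Y → ↥Z} (hφ : IsEmbedding φ) (hrange : Set.range φ = {z : ↥Z | (z : V) ∉ S})
    (hclopen : IsClopen {z : ↥Z | (z : V) ∈ S}) (hne : (Z ∩ S).Nonempty) (hfin : (irreducibleComponents ↥Z).Finite) :
    nIrrComp Y < nIrrComp ↥Z := by
  rw [← nIrrComp_range_eq_of_isEmbedding hφ, hrange]
  have hA : IsClopen ({z : ↥Z | (z : V) ∈ S}ᶜ) := hclopen.compl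
  have hAc : ({z : ↥Z | (z : V) ∈ S}ᶜ)ᶜ.Nonempty := by
    obtain ⟨z, hzZ, hzS⟩ := hne
    exact ⟨⟨z, hzZ⟩, fun h => h hzS⟩
  exact nIrrComp_subtype_lt_of_isClopen hA hAc hfin

end Summit.ResolutionOfSingularities.ResolutionOfSingularities.Theorems.WildQuotientResolution.S1.CompCount

end
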